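import Literature.MathematicalPhysics.QuantumFieldTheory.Balaban1983to89.B9SectCLatticeCarrier

/-!
# `Balaban1983to89.B9SectCLatticeFrame` — the site-level `Am₀` on the whole unit torus (per-direction reading) and
# THE d-DIMENSIONAL ONE-LEVEL BLOCK FRAME: big blocks of side `B` of the periodic lattice, the block map and its
# unit-step dichotomy, block sup-distance, zone depth, uniform lattice-sum profile, constant proper scale (census §5
# D1/D2, second carrier leaf) — OURS (typing of the printed geometric setting AT ONE LEVEL)

CITATION HEADER (LEAF RULE: no quotation in this file; pointers BY NAME only).  Balaban, *Commun. Math. Phys.* **99**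
(1985) 389–434.  §1 below concerns the `h`-linear second-order symbol of the site-level operator assembled from the
covariant derivative (3.3) (pp.390–391) and its adjoint (3.8) (p.392) — the objects typed in `…B9SectCLatticeCarrier`
§3/§3b, scalar reading.  §§2–4 concern the GEOMETRIC SETTING of the random-walk expansions of §C (p.408): the torus
partitioned into big blocks (elementary cubes of a coarser lattice; two block sizes, the bigger a multiple of the
smaller), measured with the weighted distance of (3.42) (p.397), which is the distance (2.36) of Balaban, *Commun.
Math. Phys.* **96** (1984) 223–250 whose transfer property and summation profile (2.60)–(2.61) (p.234) are what
`B9SectCDiffEstimate.Frame` / `Frame.Valid` package.  What this file takes from print is only the SHAPE of that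
setting AT ONE LEVEL (one block size, constant proper scale): blocks of side `B`, the sup-distance between blocks in
block units, the distance to a zone of blocks, the uniform lattice sums; the theorems about the block frame carry
context tags to p.408 / (3.42) p.397, those of §1 to (3.3)/(3.8).  Tree inputs, by name: `B4Sect5Torus.{TSite, tdist,
tdist_symm, tdist_self, tdist_triangle, tdist_nonneg, circAbs_le_tdist, torusSum_le, IsPseudoDist}`,
`B4TorusKernel.MultiPeriod.circAbs`, `B4Sect5Proof.{latticeConst, latticeConst_nonneg}`, `B6DomainChange.{IsDepth,
Profile}`, `B6DomainMajorant.{zoneDepth, isDepth_zoneDepth, zoneDepth_eq_zero, le_zoneDepth}`,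
`B9SectCDiffEstimate.{Frame, Frame.Valid, Transfer, OpZon}`, `B9SectCLatticeCalc.{IsCarried, IsCarried.transpose,
IsCarried.exchange, ThE, ThE_eq}`, `B9SectCLatticeOrder.{IsTab, Bonds, bond_abs_le, bond_zone, weight₂_eq,
opZon_sandwich, opZon_sum_const, opZon_cst}`, `B9SectCLatticeCarrier.{shift, unshift, shift_apply_val,
shift_apply_ne, shift_unshift, tdist_shift_le, Bond, bpos, btgt, sT, sJ, sTd, sJd, isCarried_sT, isCarried_sJ,
isTab_sT_transpose, isTab_sTd, of_ite_ne_zero, site_defect_eq_zero, fdev, thE_mul_sJ_eq_sum, thE_mul_sT_eq_sum,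
bonds_site}`; Mathlib's `Nat.mod_mul_left_div_self`, `Nat.succ_div_of_dvd`, `Nat.succ_div_of_not_dvd`,
`Nat.div_lt_of_lt_mul`, `Matrix.mul_sum`, `Finset.sum_sub_distrib`, `Int.emod_nonneg`, `Int.emod_lt_of_pos`,
`Int.emod_def`, `Real.exp_lt_exp`, `Real.one_le_exp`, `one_le_inv₀`, `one_le_pow₀`.  The only import is
`…B9SectCLatticeCarrier`.  SITE TYPE COMMITTED TO (cross-read of the carrier leaf, INFO-3): the sites are
`B4Sect5Torus.TSite` with the unit steps `B9SectCLatticeCarrier.shift` / `unshift`; the parallel lattice APIs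
`Balaban1983to89.Setup.Site`, `B5AveragingTorus`, `B16TstarCount.Bond` are not used.

WHAT THIS MODULE DOES (census `SectC-inst-census.md` §5 D1/D2, notes N25 (3)(iv)–(vi) and N26; claim
SECTC-LATTICE-FRAME).
* §1 **THE SITE-LEVEL `Am₀` ON THE WHOLE TORUS** (addendum to `…Carrier` §3b).  The `h`-linear second-order symbol
  `Am₀ = Jᵀ·Θ_h·J − Tᵀ·Θ_h·T` of the site operator `(T − J)ᵀ(T − J)` cannot be fed to `B9SectCLatticeOrder.opZon_Am₀`
  with ONE device (a site carries `d` different differences).  Read PER DIRECTION through `thE_mul_sJ_eq_sum` /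
  `thE_mul_sT_eq_sum` and the exchange rule, the `J/T`-defect of direction `l` is `diag(θ⁺_l)·(JᵀJ_l − TᵀT_l) = 0`
  for a unit-modulus bond field (`site_defect_eq_zero`), and what remains is the honest second-difference sandwich
  `am₀_lattice_eq : Am₀ = Σ_l Tᵀ·Θ_{θ⁺_l}·T_l` (`θ⁺_l = fdev h l`; the lattice Laplacian of `h` as a multiplication
  operator with the weights `c²r²`).  `opZon_Am₀_dir` / `opZon_Am₀_lattice`: each summand is in
  `𝒵(−2, d²·(|c|ρ)²·ω₁·e^{δ₀R₀})` and `Am₀ ∈ 𝒵(−2, d³·(|c|ρ)²·ω₁·e^{δ₀R₀})`, from SECOND-difference cutoff facts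
  `hmod₂` / `hzone₂` on the devices (modulus `ω₁·sc⁻²` per unit torus length within the radius `ℓ`; constancy off
  the zone) — data of the instance's cutoff, NOT consequences of a `CutModel`'s first-order `modulus` / `zone`
  (caveat (2)) — via `B9SectCLatticeOrder.opZon_sandwich` with the `(d, |c|ρ)`-table `Tᵀ`, the `(1, |c|ρ)`-table
  `T_l` and the bond facts `…Carrier.bonds_site`.
* §2 **BLOCKS**: the fine periods `fine Qd B = (Q_i·B)_i` (divisibility by construction), the block map
  `blk : TSite d (fine Qd B) → TSite d Qd`, `x_i ↦ ⌊x_i / B⌋`, and THE UNIT-STEP DICHOTOMY `blk_shift`: `blk (x + e_k)`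
  is `blk x + e_k` if `B ∣ x_k + 1` and `blk x` otherwise (`Nat.mod_mul_left_div_self`:
  `((x_k + 1) mod Q_kB) / B = ((x_k + 1) / B) mod Q_k`, the wrap-around included); hence `tdist_blk_shift_le` /
  `tdist_blk_unshift_le`: a unit step of the fine lattice moves the block by block-distance `≤ 1` — the `hfrm` datum
  of `…Carrier.bonds_of_steps` with `R = 1`; `fine_pos` (`1 ≤ Q_i·B`); `one_le_tdist_of_ne` (distinct blocks are at
  block-distance `≥ 1`).
* §3 **THE BLOCK FRAME** `blockFrame Qd N hN B κ δ₀ : Frame (TSite d Qd)`: `ρ = tdist Qd` (block sup-distance in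
  block units), `β = zoneDepth ρ N` (distance to a non-empty zone `N` of blocks — where the instance's cut is made),
  `K a = κ·latticeConst d a` (the uniform torus lattice sum of `B4Sect5Torus.torusSum_le`, with a multiplicity
  `κ ≥ 1` for non-injective coarse families), `sc ≡ B` (ONE level: constant proper scale), rate `δ₀`, unit loss
  `u = δ₀/20`, `Λ = 1`; `blockFrame_valid` (`Frame.Valid` for `Q_i ≥ 1`, `B ≥ 1`, `κ ≥ 1`, `δ₀ > 0`: the transfer
  (2.60) is trivial at constant scale, `K(u) ≥ 1` by `one_le_latticeConst`); the uniform profile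
  `blockFrame_profile` of the identity family of blocks; `blockFrame_β_eq_zero` on the zone, `one_le_blockFrame_β`
  off it; `blockFrame_hfrm` / `blockFrame_hfrm'` = §2 read through the frame.
* §4 **SANITY**: `opZon_Am₀_blocks` — §1 on the block frame with `ys := blk`, `R = 1` (`hfrm` discharged by
  `blockFrame_hfrm`, validity by `blockFrame_valid`, `hP` by `fine_pos`): the end-to-end check that §§2–3 supply
  exactly the frame data the order theorems of `…Order` / `…Carrier` consume.  Nothing new is proved there.

HONEST CAVEATS.  (1) ONE LEVEL ONLY: a single block size `B` and a CONSTANT proper scale; the printed setting is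
multiscale (a sequence of coarser lattices and domains, blocks of growing side, cubes and their enlargements, a
proper scale varying with the position) — that tower, the lattice spacings and the boundary deletions are NOT typed
here (instance-side or out of scope, census §5 D1).  (2) The second-difference facts `hmod₂` / `hzone₂` of §1/§4 are
HYPOTHESES on the cutoff; they do not follow from a `CutModel`'s first-order `modulus` / `zone`.  (3) SCALAR READING
`n = 1` and a unit-modulus bond field (`r² = 1`) in §1, as in `…Carrier` caveat (1); `0 ≤ ρ` is assumed explicitly
(the bound `|r| ≤ ρ` does not give it on an empty lattice).  (4) CONSTANTS explicit, not optimised (`d³`, `κ`).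
(5) NO `TwoSeq` / `CutModel` TERM is built (0 `instance`): the one `CutModel` term of census §5 D2 needs the seven
`OpLoc` records of a full two-sequence datum and is the next leaf; this file supplies its frame `F`, its validity,
the position map of sites into the frame (`blk`) with `hfrm`, and the profile `(P)` for identity coarse families.
(6) NOT summit progress: typing and bookkeeping only.
-/

namespace Literature.MathematicalPhysics.QuantumFieldTheory.Balaban1983to89.B9SectCLatticeFrame

open Finset
open B4TorusKernel.MultiPeriod (circAbs)
open B4Sect5Torus (TSite tdist tdist_symm tdist_self tdist_triangle tdist_nonneg circAbs_le_tdist torusSum_le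
  IsPseudoDist)
open B4Sect5Proof (latticeConst latticeConst_nonneg)
open B6DomainChange (IsDepth Profile)
open B6DomainMajorant (zoneDepth isDepth_zoneDepth zoneDepth_eq_zero le_zoneDepth)
open B9SectCDiffEstimate
open B9SectCLatticeCalc (IsCarried ThE ThE_eq)
open B9SectCLatticeOrder (IsTab Bonds bond_abs_le bond_zone weight₂_eq opZon_sandwich opZon_sum_const opZon_cst)
open B9SectCLatticeCarrier

noncomputable section

/-! ## §1 The site-level `Am₀` on the whole torus: per-direction reading, vanishing defect, second differences -/

section SiteAm₀

variable {d : ℕ} {Pd : Fin d → ℕ}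

/-- **`Am₀` OF THE SITE OPERATOR, PER DIRECTION**: for a unit-modulus bond field,
`Jᵀ·Θ_h·J − Tᵀ·Θ_h·T = Σ_l Tᵀ·Θ_{θ⁺_l}·T_l` — the first-difference × defect terms vanish direction by direction
(`site_defect_eq_zero`) and the `h`-linear second-order symbol of `(T − J)ᵀ(T − J)` is a sum of SECOND differences
of `h` (its lattice Laplacian as a multiplication operator). OURS (typing).
[cite: Balaban1985BackgroundPropagators, (3.3) pp.390–391 and (3.8) p.392] -/
theorem am₀_lattice_eq (h : TSite d Pd → ℝ) (c : ℝ) {r : Bond d Pd → ℝ} (hr : ∀ a, r a ^ 2 = 1) :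
    (sJ c : Matrix (Bond d Pd) (TSite d Pd) ℝ).transpose * ThE (bpos : Bond d Pd → TSite d Pd) btgt h *
          (sJ c : Matrix (Bond d Pd) (TSite d Pd) ℝ) -
        (sT c r).transpose * ThE (bpos : Bond d Pd → TSite d Pd) btgt h * sT c r =
      ∑ l, (sT c r).transpose * ThE (bpos : Bond d Pd → TSite d Pd) btgt (fdev h l) * sTd c r l := by
  have hc : ∀ l : Fin d, (fun a : Bond d Pd => fdev h l (bpos a)) = fdev h l ∘ (bpos : Bond d Pd → TSite d Pd) :=
    fun _ => rfl
  rw [Matrix.mul_assoc, thE_mul_sJ_eq_sum, Matrix.mul_sum, Matrix.mul_assoc (sT c r).transpose,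
    thE_mul_sT_eq_sum, Matrix.mul_sum, ← Finset.sum_sub_distrib]
  refine Finset.sum_congr rfl fun l _ => ?_
  have hd : Matrix.diagonal (fdev h l ∘ (bpos : Bond d Pd → TSite d Pd)) =
      Matrix.diagonal (fdev h l ∘ (btgt : Bond d Pd → TSite d Pd)) -
        ThE (bpos : Bond d Pd → TSite d Pd) btgt (fdev h l) := by
    rw [ThE_eq, sub_sub_cancel]
  rw [hc l, ← Matrix.mul_assoc, ← Matrix.mul_assoc, ← (isCarried_sJ c).transpose.exchange (fdev h l), hd,
    Matrix.mul_sub, ← (isCarried_sT c r).transpose.exchange (fdev h l), Matrix.sub_mul, ← sub_add,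
    Matrix.mul_assoc (Matrix.diagonal _), Matrix.mul_assoc (Matrix.diagonal _), ← Matrix.mul_sub,
    site_defect_eq_zero hr l, Matrix.mul_zero, zero_add]

variable {S U V : Type*} [DecidableEq V] {F : Frame S} {ys : TSite d Pd → S} {ℓ : TSite d Pd → ℝ}
  {h : TSite d Pd → ℝ} {ω₁ R R₀ c ρ : ℝ} {r : Bond d Pd → ℝ} {pU : U → S} {pV : V → S}
  {bs : TSite d Pd → U} {bs' : TSite d Pd → V}

/-- **ONE DIRECTION OF `Am₀` IS IN `𝒵(−2, d²·(|c|ρ)²·ω₁·e^{δ₀R₀})`**: the sandwich `Tᵀ·Θ_{θ⁺_l}·T_l` of the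
`(d, |c|ρ)`-table `Tᵀ` and the `(1, |c|ρ)`-table `T_l` around the SECOND differences `θ⁺_l(b₊) − θ⁺_l(b₋)` of `h`,
under the second-difference cutoff facts: within the radius `ℓ ≥ 1`, `θ⁺_l = fdev h l` has modulus `ω₁·sc⁻²` per
unit torus length (`hmod₂`) and is constant off the zone (`hzone₂`); blocks `bs`, `bs′` of the sites with `bs` OVER
the site map `ys` (`hbs`) and `bs′` within frame distance `R₀` of it (`hbs′`); neighbouring sites within frame
distance `R` (`hfrm`).  `B9SectCLatticeOrder.opZon_sandwich` with the bond facts `…Carrier.bonds_site`. OURS.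
[cite: Balaban1985BackgroundPropagators, (3.3) pp.390–391 and (3.8) p.392] -/
theorem opZon_Am₀_dir (hF : F.Valid) (hP : ∀ i, 1 ≤ Pd i) (hω₁ : 0 ≤ ω₁) (hℓ : ∀ x, 1 ≤ ℓ x) (hR : 0 ≤ R)
    (hfrm : ∀ x k, F.ρ (ys x) (ys (shift k x)) ≤ R)
    (hmod₂ : ∀ l e e', tdist Pd e e' ≤ ℓ e → |fdev h l e - fdev h l e'| ≤ ω₁ * (F.sc (ys e) ^ 2)⁻¹ * tdist Pd e e')
    (hzone₂ : ∀ l e e', tdist Pd e e' ≤ ℓ e → fdev h l e ≠ fdev h l e' → F.β (ys e) = 0)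
    (hρ : 0 ≤ ρ) (hr : ∀ a, |r a| ≤ ρ) (hbs : ∀ y, pU (bs y) = ys y) (hbs' : ∀ y, F.ρ (ys y) (pV (bs' y)) ≤ R₀)
    (l : Fin d) :
    OpZon F bs bs' pU pV (-2) (((d * 1 : ℕ) : ℝ) * (d * (|c| * ρ * (ω₁ * 1) * (|c| * ρ))) * Real.exp (F.δ₀ * R₀))
      ((sT c r).transpose * ThE (bpos : Bond d Pd → TSite d Pd) btgt (fdev h l) * sTd c r l) := by
  have hb := bonds_site (F := F) (ys := ys) hP hℓ hR hfrm
  have hcρ : 0 ≤ |c| * ρ := mul_nonneg (abs_nonneg c) hρ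
  rw [ThE]
  refine opZon_sandwich hF (isTab_sT_transpose hr) (isTab_sTd hr l) hcρ hcρ (mul_nonneg hω₁ zero_le_one) hbs
    (fun x a hxa => ?_) (fun x a hxa hne => ?_) (fun x a z hxa haz => ?_)
  · have e : x = btgt a := (isCarried_sT c r).transpose x a hxa
    subst e
    rw [← weight₂_eq]
    exact (bond_abs_le (hmod₂ l) (fun e => mul_nonneg hω₁ (inv_nonneg.2 (pow_nonneg (hF.hsc _).le 2))) hb () a).2
  · have e : x = btgt a := (isCarried_sT c r).transpose x a hxa
    subst e
    exact (bond_zone (hzone₂ l) hb (k := ()) (sub_ne_zero.1 hne)).2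
  · have e : x = btgt a := (isCarried_sT c r).transpose x a hxa
    subst e
    have ez : z = btgt a := (of_ite_ne_zero (of_ite_ne_zero haz).2).1
    subst ez
    exact hbs' _

/-- **THE SITE-LEVEL `Am₀` ON THE WHOLE UNIT TORUS IS IN `𝒵(−2, d³·(|c|ρ)²·ω₁·e^{δ₀R₀})`** for a unit-modulus
bond field (`r² = 1`, `|r| ≤ ρ`): `am₀_lattice_eq` + `opZon_Am₀_dir` summed over the `d` directions
(`opZon_sum_const`).  The second-order half of the `hA` shape of `B9SectCLatticeCalc` for the operator of
(3.3)/(3.8) on the periodic lattice, with NO defect hypothesis left (contrast `B9SectCLatticeOrder.opZon_Am₀`, whose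
`hdef` cannot be met by one global device in `d ≥ 2` directions). OURS.
[cite: Balaban1985BackgroundPropagators, (3.3) pp.390–391 and (3.8) p.392] -/
theorem opZon_Am₀_lattice (hF : F.Valid) (hP : ∀ i, 1 ≤ Pd i) (hω₁ : 0 ≤ ω₁) (hℓ : ∀ x, 1 ≤ ℓ x) (hR : 0 ≤ R)
    (hfrm : ∀ x k, F.ρ (ys x) (ys (shift k x)) ≤ R)
    (hmod₂ : ∀ l e e', tdist Pd e e' ≤ ℓ e → |fdev h l e - fdev h l e'| ≤ ω₁ * (F.sc (ys e) ^ 2)⁻¹ * tdist Pd e e')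
    (hzone₂ : ∀ l e e', tdist Pd e e' ≤ ℓ e → fdev h l e ≠ fdev h l e' → F.β (ys e) = 0)
    (hρ : 0 ≤ ρ) (hr : ∀ a, |r a| ≤ ρ) (hr₂ : ∀ a, r a ^ 2 = 1) (hbs : ∀ y, pU (bs y) = ys y)
    (hbs' : ∀ y, F.ρ (ys y) (pV (bs' y)) ≤ R₀) :
    OpZon F bs bs' pU pV (-2) ((d : ℝ) ^ 3 * ((|c| * ρ) ^ 2 * ω₁) * Real.exp (F.δ₀ * R₀))
      ((sJ c : Matrix (Bond d Pd) (TSite d Pd) ℝ).transpose * ThE (bpos : Bond d Pd → TSite d Pd) btgt h *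
          (sJ c : Matrix (Bond d Pd) (TSite d Pd) ℝ) -
        (sT c r).transpose * ThE (bpos : Bond d Pd → TSite d Pd) btgt h * sT c r) := by
  rw [am₀_lattice_eq h c hr₂]
  refine opZon_cst (opZon_sum_const fun l =>
    opZon_Am₀_dir hF hP hω₁ hℓ hR hfrm hmod₂ hzone₂ hρ hr hbs hbs' l) ?_
  rw [Fintype.card_fin]; push_cast; ring

end SiteAm₀

/-! ## §2 Blocks: fine periods, the block map, the unit-step dichotomy -/

section Blocks

variable {d : ℕ} {Qd : Fin d → ℕ} {B : ℕ}

/-- **THE FINE PERIODS**: `Q_i` big blocks of side `B` per direction — the torus `Π_i ℤ/(Q_i·B)ℤ` of sites over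
the torus `Π_i ℤ/Q_iℤ` of blocks (divisibility of the periods by the block side holds by construction).
OURS (typing). [folklore] -/
abbrev fine (Qd : Fin d → ℕ) (B : ℕ) : Fin d → ℕ := fun i => Qd i * B

/-- the fine periods are `≥ 1` when `Q_i ≥ 1` and `B ≥ 1` (the `hP` of `…B9SectCLatticeCarrier`). OURS (typing).
[cite: Balaban1985BackgroundPropagators, §C p.408] -/
theorem fine_pos (hQ : ∀ i, 1 ≤ Qd i) (hB : 1 ≤ B) : ∀ i, 1 ≤ fine Qd B i := fun i => Nat.mul_pos (hQ i) hB

/-- **THE BLOCK MAP** `x ↦ (⌊x_i / B⌋)_i`: the big block (elementary cube of side `B` of the coarser lattice)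
containing the site `x`. OURS (typing). [folklore] -/
def blk (x : TSite d (fine Qd B)) : TSite d Qd := fun i =>
  ⟨(x i).val / B, Nat.div_lt_of_lt_mul (by rw [Nat.mul_comm]; exact (x i).isLt)⟩

/-- the block coordinates are the integer quotients of the site coordinates. OURS (typing).
[cite: Balaban1985BackgroundPropagators, §C p.408] -/
theorem blk_apply_val (x : TSite d (fine Qd B)) (i : Fin d) : ((blk x) i).val = (x i).val / B := rfl

/-- **THE UNIT-STEP DICHOTOMY**: `blk (x + e_k) = blk x + e_k` if the step crosses a block face (`B ∣ x_k + 1`,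
wrap-around of the torus included) and `blk (x + e_k) = blk x` otherwise. OURS (typing).
[cite: Balaban1985BackgroundPropagators, §C p.408] -/
theorem blk_shift (k : Fin d) (x : TSite d (fine Qd B)) :
    blk (shift k x) = if B ∣ (x k).val + 1 then shift k (blk x) else blk x := by
  have key : ((blk (shift k x)) k).val = ((x k).val + 1) / B % Qd k := by
    rw [blk_apply_val, shift_apply_val]; exact Nat.mod_mul_left_div_self _ _ _
  split_ifs with hdvd
  · funext i
    by_cases hi : i = k
    · subst hi; apply Fin.ext; rw [key, shift_apply_val, blk_apply_val, Nat.succ_div_of_dvd hdvd]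
    · apply Fin.ext; rw [blk_apply_val, shift_apply_ne hi, shift_apply_ne hi, blk_apply_val]
  · funext i
    by_cases hi : i = k
    · subst hi; apply Fin.ext; rw [key, Nat.succ_div_of_not_dvd hdvd]; exact Nat.mod_eq_of_lt ((blk x) i).isLt
    · apply Fin.ext; rw [blk_apply_val, shift_apply_ne hi, blk_apply_val]

/-- **A UNIT STEP MOVES THE BLOCK BY BLOCK-DISTANCE `≤ 1`** (forward step, read from the source) — the `hfrm`
datum of `…B9SectCLatticeCarrier.bonds_of_steps` for the block frame, `R = 1`. OURS (typing).
[cite: Balaban1985BackgroundPropagators, §C p.408 and (3.42) p.397] -/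
theorem tdist_blk_shift_le (hQ : ∀ i, 1 ≤ Qd i) (k : Fin d) (x : TSite d (fine Qd B)) :
    tdist Qd (blk x) (blk (shift k x)) ≤ 1 := by
  rw [blk_shift]
  split_ifs
  · exact tdist_shift_le hQ k (blk x)
  · rw [tdist_self]; exact zero_le_one

/-- … and for the backward step, read from the target: `tdist (blk (x − e_k)) (blk x) ≤ 1`. OURS (typing).
[cite: Balaban1985BackgroundPropagators, §C p.408 and (3.42) p.397] -/
theorem tdist_blk_unshift_le (hQ : ∀ i, 1 ≤ Qd i) (k : Fin d) (x : TSite d (fine Qd B)) :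
    tdist Qd (blk (unshift k x)) (blk x) ≤ 1 := by
  have h := tdist_blk_shift_le hQ k (unshift k x)
  rwa [shift_unshift] at h

/-- a non-zero integer of modulus `< N` is at circular distance `≥ 1` from `Nℤ`. [folklore] -/
private theorem one_le_circAbs {N : ℕ} {z : ℤ} (hz : z ≠ 0) (hzN : |z| < N) : 1 ≤ circAbs N z := by
  have hN : (0 : ℤ) < N := (abs_nonneg z).trans_lt hzN
  have h0 : 0 ≤ z % N := Int.emod_nonneg z hN.ne'
  have h1 : z % N < N := Int.emod_lt_of_pos z hN
  have hne : z % N ≠ 0 := by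
    intro h
    have hq : z = N * (z / N) := by have := Int.emod_def z N; linarith
    have hq0 : z / N ≠ 0 := by intro h0; rw [h0, mul_zero] at hq; exact hz hq
    have : (N : ℤ) ≤ |z| := by
      rw [hq, abs_mul, abs_of_pos hN]; exact le_mul_of_one_le_right hN.le (Int.one_le_abs hq0)
    linarith
  unfold circAbs
  omega

/-- **DISTINCT BLOCKS ARE AT BLOCK-DISTANCE `≥ 1`** (so a block off the zone has depth `≥ 1`,
`one_le_blockFrame_β`). OURS (typing). [cite: Balaban1985BackgroundPropagators, §C p.408 and (3.42) p.397] -/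
theorem one_le_tdist_of_ne (hQ : ∀ i, 1 ≤ Qd i) {I J : TSite d Qd} (hIJ : I ≠ J) : 1 ≤ tdist Qd I J := by
  obtain ⟨i, hi⟩ := Function.ne_iff.1 hIJ
  have hv : (I i).val ≠ (J i).val := fun h => hi (Fin.ext h)
  have hlt₁ := (I i).isLt
  have hlt₂ := (J i).isLt
  have h1 : (1 : ℤ) ≤ circAbs (Qd i) (((I i).val : ℤ) - ((J i).val : ℤ)) :=
    one_le_circAbs (by omega) (by rw [abs_lt]; constructor <;> omega)
  have h3 : (1 : ℝ) ≤ (circAbs (Qd i) (((I i).val : ℤ) - ((J i).val : ℤ)) : ℝ) := by exact_mod_cast h1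
  exact h3.trans (circAbs_le_tdist hQ I J i)

end Blocks

/-! ## §3 The one-level block frame -/

section BlockFrame

variable {d : ℕ}

/-- **THE ONE-LEVEL BLOCK FRAME** on the blocks `Π_i ℤ/Q_iℤ`: `ρ` = block sup-distance in block units, depth
`β = zoneDepth ρ N` to a non-empty zone `N` of blocks, profile `K a = κ·K_d(a)` (uniform torus lattice sum with a
multiplicity `κ`), proper scale `sc ≡ B` (ONE level), rate `δ₀`, unit loss `u = δ₀/20`, transfer constant `Λ = 1`.
OURS (typing). [folklore] -/
def blockFrame (Qd : Fin d → ℕ) (N : Finset (TSite d Qd)) (hN : N.Nonempty) (B : ℕ) (κ δ₀ : ℝ) :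
    Frame (TSite d Qd) where
  ρ := tdist Qd
  β := zoneDepth (tdist Qd) N hN
  K := fun a => κ * latticeConst d a
  sc := fun _ => (B : ℝ)
  δ₀ := δ₀
  u := δ₀ / 20
  Λ := 1

variable {Qd : Fin d → ℕ} {N : Finset (TSite d Qd)} {hN : N.Nonempty} {B : ℕ} {κ δ₀ : ℝ}

/-- the block pseudo-distance is the block sup-distance. OURS (typing).
[cite: Balaban1985BackgroundPropagators, (3.42) p.397] -/
@[simp] theorem blockFrame_ρ : (blockFrame Qd N hN B κ δ₀).ρ = tdist Qd := rfl

/-- the depth is the distance to the zone. OURS (typing). [cite: Balaban1985BackgroundPropagators, (3.42) p.397] -/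
@[simp] theorem blockFrame_β : (blockFrame Qd N hN B κ δ₀).β = zoneDepth (tdist Qd) N hN := rfl

/-- the profile is the uniform lattice sum with multiplicity. OURS (typing).
[cite: Balaban1985BackgroundPropagators, §C p.408] -/
@[simp] theorem blockFrame_K (a : ℝ) : (blockFrame Qd N hN B κ δ₀).K a = κ * latticeConst d a := rfl

/-- the proper scale is the block side, at every block. OURS (typing).
[cite: Balaban1985BackgroundPropagators, §C p.408] -/
@[simp] theorem blockFrame_sc (I : TSite d Qd) : (blockFrame Qd N hN B κ δ₀).sc I = (B : ℝ) := rfl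

/-- the rate. OURS (typing). [cite: Balaban1985BackgroundPropagators, §C p.408] -/
@[simp] theorem blockFrame_δ₀ : (blockFrame Qd N hN B κ δ₀).δ₀ = δ₀ := rfl

/-- the unit loss. OURS (typing). [cite: Balaban1985BackgroundPropagators, §C p.408] -/
@[simp] theorem blockFrame_u : (blockFrame Qd N hN B κ δ₀).u = δ₀ / 20 := rfl

/-- the transfer constant. OURS (typing). [cite: Balaban1985BackgroundPropagators, §C p.408] -/
@[simp] theorem blockFrame_Λ : (blockFrame Qd N hN B κ δ₀).Λ = 1 := rfl

/-- the block sup-distance is a pseudo-distance. [folklore] -/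
private theorem tdist_isPseudoDist (hQ : ∀ i, 1 ≤ Qd i) : IsPseudoDist (tdist Qd) :=
  { symm := tdist_symm hQ, zero := tdist_self Qd, triangle := tdist_triangle hQ }

/-- the uniform lattice-sum constant is `≥ 1` at positive rate. [folklore] -/
private theorem one_le_latticeConst (d : ℕ) {a : ℝ} (ha : 0 < a) : 1 ≤ latticeConst d a := by
  unfold latticeConst
  rcases Nat.eq_zero_or_pos d with hd | hd
  · subst hd; rw [pow_zero]
  · apply one_le_pow₀
    have hd' : (0 : ℝ) < d := by exact_mod_cast hd
    have h1 : Real.exp (-(a / d)) < 1 := by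
      rw [← Real.exp_zero]; exact Real.exp_lt_exp.2 (by have := div_pos ha hd'; linarith)
    have h2 : 0 < 1 - Real.exp (-(a / d)) := by linarith
    have h3 : 1 ≤ (1 - Real.exp (-(a / d)))⁻¹ := (one_le_inv₀ h2).2 (by linarith [Real.exp_pos (-(a / d))])
    linarith

/-- **`Frame.Valid` OF THE BLOCK FRAME** for `Q_i ≥ 1`, `B ≥ 1`, `κ ≥ 1`, `δ₀ > 0`: pseudo-distance and depth
(`isDepth_zoneDepth`), `K ≥ 0`, `sc > 0`, the transfer (2.60) trivially at constant scale with `Λ = 1`,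
`K(u) ≥ 1`, `20u = δ₀`. OURS (typing).
[cite: Balaban1985BackgroundPropagators, §C p.408 and (3.42) p.397] -/
theorem blockFrame_valid (hQ : ∀ i, 1 ≤ Qd i) (hB : 1 ≤ B) (hκ : 1 ≤ κ) (hN : N.Nonempty) (hδ₀ : 0 < δ₀) :
    (blockFrame Qd N hN B κ δ₀).Valid where
  hρ := tdist_isPseudoDist hQ
  hβ := isDepth_zoneDepth (tdist_isPseudoDist hQ) N hN
  hK a ha := by
    show 0 ≤ κ * latticeConst d a
    exact mul_nonneg (zero_le_one.trans hκ) (latticeConst_nonneg d ha.le)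
  hsc I := by show (0 : ℝ) < B; exact Nat.cast_pos.2 hB
  htr k _ _ := by
    intro I J
    show (B : ℝ) ^ k ≤ 1 * (B : ℝ) ^ k * Real.exp (δ₀ / 20 * tdist Qd I J)
    rw [one_mul]
    exact le_mul_of_one_le_right (zpow_nonneg (Nat.cast_nonneg B) k)
      (Real.one_le_exp (mul_nonneg (by linarith) (tdist_nonneg Qd I J)))
  hu := by show 0 < δ₀ / 20; linarith
  hΛ := le_refl _
  hKu := by
    show 1 ≤ κ * latticeConst d (δ₀ / 20)
    exact one_le_mul_of_one_le_of_one_le hκ (one_le_latticeConst d (by linarith))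
  hδ₀ := by show 20 * (δ₀ / 20) ≤ δ₀; linarith

/-- **THE UNIFORM PROFILE `(P)` OF THE BLOCKS**: `Σ_J e^{−a·ρ(I, J)} ≤ κ·K_d(a)` for every block `I` and rate
`a > 0` — `B4Sect5Torus.torusSum_le` (uniform in the periods) and `κ ≥ 1`; the `Profile F.ρ id F.K` of an identity
coarse family. OURS (typing). [cite: Balaban1985BackgroundPropagators, §C p.408 and (3.42) p.397] -/
theorem blockFrame_profile (hQ : ∀ i, 1 ≤ Qd i) (hκ : 1 ≤ κ) :
    Profile (blockFrame Qd N hN B κ δ₀).ρ id (blockFrame Qd N hN B κ δ₀).K := by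
  intro a ha I
  show ∑ J : TSite d Qd, Real.exp (-(a * tdist Qd I (id J))) ≤ κ * latticeConst d a
  exact (torusSum_le d hQ ha I).trans (le_mul_of_one_le_left (latticeConst_nonneg d ha.le) hκ)

/-- the depth VANISHES ON THE ZONE. OURS (typing). [cite: Balaban1985BackgroundPropagators, (3.42) p.397] -/
theorem blockFrame_β_eq_zero (hQ : ∀ i, 1 ≤ Qd i) {I : TSite d Qd} (hI : I ∈ N) :
    (blockFrame Qd N hN B κ δ₀).β I = 0 :=
  zoneDepth_eq_zero (tdist_isPseudoDist hQ) hN hI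

/-- a block OFF THE ZONE has depth `≥ 1`. OURS (typing). [cite: Balaban1985BackgroundPropagators, (3.42) p.397] -/
theorem one_le_blockFrame_β (hQ : ∀ i, 1 ≤ Qd i) {I : TSite d Qd} (hI : I ∉ N) :
    1 ≤ (blockFrame Qd N hN B κ δ₀).β I :=
  le_zoneDepth (tdist Qd) hN fun _ hJ => one_le_tdist_of_ne hQ fun h => hI (h ▸ hJ)

/-- **`hfrm` WITH `R = 1`**: neighbouring sites of the fine lattice lie in blocks at frame distance `≤ 1`
(forward step). OURS (typing). [cite: Balaban1985BackgroundPropagators, §C p.408 and (3.42) p.397] -/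
theorem blockFrame_hfrm (hQ : ∀ i, 1 ≤ Qd i) :
    ∀ (x : TSite d (fine Qd B)) (k : Fin d),
      (blockFrame Qd N hN B κ δ₀).ρ (blk x) (blk (shift k x)) ≤ 1 :=
  fun x k => tdist_blk_shift_le hQ k x

/-- … (backward step, read from the target). OURS (typing).
[cite: Balaban1985BackgroundPropagators, §C p.408 and (3.42) p.397] -/
theorem blockFrame_hfrm' (hQ : ∀ i, 1 ≤ Qd i) :
    ∀ (x : TSite d (fine Qd B)) (k : Fin d),
      (blockFrame Qd N hN B κ δ₀).ρ (blk (unshift k x)) (blk x) ≤ 1 :=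
  fun x k => tdist_blk_unshift_le hQ k x

end BlockFrame

/-! ## §4 Sanity: the site-level `Am₀` of §1 on the block frame of §3 -/

section Sanity

variable {d : ℕ} {Qd : Fin d → ℕ} {N : Finset (TSite d Qd)} {hN : N.Nonempty} {B : ℕ} {κ δ₀ : ℝ}
  {U V : Type*} [DecidableEq V] {ℓ : TSite d (fine Qd B) → ℝ} {h : TSite d (fine Qd B) → ℝ} {ω₁ R₀ c ρ : ℝ}
  {r : Bond d (fine Qd B) → ℝ} {pU : U → TSite d Qd} {pV : V → TSite d Qd}
  {bs : TSite d (fine Qd B) → U} {bs' : TSite d (fine Qd B) → V}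

/-- **`Am₀` OF THE SITE OPERATOR ON THE BLOCK FRAME IS IN `𝒵(−2, d³·(|c|ρ)²·ω₁·e^{δ₀R₀})`**: `opZon_Am₀_lattice`
with `F := blockFrame …`, `ys := blk`, `R = 1` — validity by `blockFrame_valid`, `hP` by `fine_pos`, `hfrm` by
`blockFrame_hfrm`; the cutoff facts now read with the constant proper scale `B` (`ω₁·B⁻²` per unit torus length).
Nothing new is proved: the end-to-end check that §§2–3 are the frame data the order theorems consume. OURS (typing).
[cite: Balaban1985BackgroundPropagators, (3.3) pp.390–391 and §C p.408] -/
theorem opZon_Am₀_blocks (hQ : ∀ i, 1 ≤ Qd i) (hB : 1 ≤ B) (hκ : 1 ≤ κ) (hN : N.Nonempty) (hδ₀ : 0 < δ₀)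
    (hω₁ : 0 ≤ ω₁) (hℓ : ∀ x, 1 ≤ ℓ x)
    (hmod₂ : ∀ l e e', tdist (fine Qd B) e e' ≤ ℓ e →
      |fdev h l e - fdev h l e'| ≤ ω₁ * (((B : ℝ)) ^ 2)⁻¹ * tdist (fine Qd B) e e')
    (hzone₂ : ∀ l e e', tdist (fine Qd B) e e' ≤ ℓ e → fdev h l e ≠ fdev h l e' →
      zoneDepth (tdist Qd) N hN (blk e) = 0)
    (hρ : 0 ≤ ρ) (hr : ∀ a, |r a| ≤ ρ) (hr₂ : ∀ a, r a ^ 2 = 1) (hbs : ∀ y, pU (bs y) = blk y)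
    (hbs' : ∀ y, tdist Qd (blk y) (pV (bs' y)) ≤ R₀) :
    OpZon (blockFrame Qd N hN B κ δ₀) bs bs' pU pV (-2) ((d : ℝ) ^ 3 * ((|c| * ρ) ^ 2 * ω₁) * Real.exp (δ₀ * R₀))
      ((sJ c : Matrix (Bond d (fine Qd B)) (TSite d (fine Qd B)) ℝ).transpose *
            ThE (bpos : Bond d (fine Qd B) → TSite d (fine Qd B)) btgt h *
          (sJ c : Matrix (Bond d (fine Qd B)) (TSite d (fine Qd B)) ℝ) -
        (sT c r).transpose * ThE (bpos : Bond d (fine Qd B) → TSite d (fine Qd B)) btgt h * sT c r) :=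
  opZon_Am₀_lattice (F := blockFrame Qd N hN B κ δ₀) (ys := blk) (blockFrame_valid hQ hB hκ hN hδ₀) (fine_pos hQ hB)
    hω₁ hℓ zero_le_one (blockFrame_hfrm hQ) hmod₂ hzone₂ hρ hr hr₂ hbs hbs'

end Sanity

end

end Literature.MathematicalPhysics.QuantumFieldTheory.Balaban1983to89.B9SectCLatticeFrame
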